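import Literature.AlgebraicGeometry.AbelianVarieties.MarkmanDescendedTransformCoh
import Literature.AlgebraicGeometry.Modules.BoxTensorExactRight
import Literature.AlgebraicGeometry.Modules.StrictlyPerfectResolution
import Literature.AlgebraicGeometry.Morphisms.FormalFunctionsModule
import Mathlib.CategoryTheory.Limits.Preserves.Shapes.Kernels
import HarnessLib

/-!
# `G ⊠ H` is coherent for `G` with a finite locally free presentation and `H` coherent

Layer `Literature/AlgebraicGeometry/Modules` (0 named facts, no instances). For a span of schemes `p : Z ⟶ X`, `q : Z ⟶ Y` with `Y`, `Z`
locally noetherian, an `𝒪_X`-module `G` admitting a strictly perfect resolution `R` (only the presentation `R⁻¹ → R⁰ → G → 0` is used)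
and a COHERENT `𝒪_Y`-module `H`, the external tensor product `G ⊠ H = p^*G ⊗ q^*H` (`Modules/BoxTensor`) is coherent
(`coh_boxTensor`). Proof: `M ↦ M ⊠ H` is right exact (`Modules/BoxTensorExactRight.preservesFiniteColimits_boxTensorFunctor_flip_obj`),
so `G ⊠ H ≅ coker(R⁻¹ ⊠ H → R⁰ ⊠ H)` (Mathlib `PreservesCokernel.iso` at the cokernel presentation `G ≅ coker(R⁻¹ → R⁰)` of
`StrictlyPerfectResolution.exact_π`/`epi_π`), and `Rⁱ ⊠ H = p^*Rⁱ ⊗ q^*H` is coherent — finite locally free tensor coherent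
(`coh_tensorObj_of_isFiniteLocallyFree`, which is where the import of `AbelianVarieties/MarkmanDescendedTransformCoh` comes from, and
`Modules/PullbackCoh.coh_pullback`); cokernels of coherent modules are coherent (`Morphisms/FormalFunctionsModule.Coh.cokernel`).
Universe `0` (that of `coh_tensorObj_of_isFiniteLocallyFree`). Also `coh_of_iso` (coherence is invariant under isomorphism).

Use: cell `pub-hodge-ring2`, crux 26512 — discharges the input `hF₀ : Coh (F₀₁ ⊠ F₀₂)` of the `e₂` placement theorems
(`Theorems/VHCAbelianSchemesRoadBoxIsoOfThetaBoxPresentation`); research route conditional on HC_CM, not a corollary — nothing here refers to it.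

## References

* R. Hartshorne, *Algebraic Geometry* (1977), II Prop. 5.7 and Cor. 5.8 context (coherence of cokernels, pull-backs), II Ex. 5.1 (b). [Hartshorne1977]
* The Stacks Project, Tag 0FXX (`K ⊠ M`), Tag 01BQ (pull-back of finitely presented modules). [StacksProject]
-/

noncomputable section

-- `TopCat.Presheaf`/`Scheme.Modules` are not reducible (as in Mathlib's `AlgebraicGeometry/Modules`).
set_option backward.isDefEq.respectTransparency false

open CategoryTheory CategoryTheory.Limits AlgebraicGeometry

namespace Literature.AlgebraicGeometry.Modules

open Literature.AlgebraicGeometry.Morphisms Literature.AlgebraicGeometry.Motives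

/-- Coherence is invariant under isomorphisms of modules. [cite: Hartshorne1977, II Prop. 5.7] -/
theorem coh_of_iso {X : Scheme.{0}} {M N : X.Modules} (e : M ≅ N) (hM : Coh M) : Coh N :=
  ⟨IsAffineLocalizing.of_iso e hM.loc, IsAffineFiniteType.of_iso e hM.ft⟩

variable {X Y Z : Scheme.{0}} (p : Z ⟶ X) (q : Z ⟶ Y) [IsLocallyNoetherian Y] [IsLocallyNoetherian Z]
  {G : X.Modules} {H : Y.Modules}

/-- **`G ⊠ H = p^*G ⊗ q^*H` is coherent** for `G` with a strictly perfect resolution (a finite locally free presentation suffices) and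
`H` coherent, `Y`, `Z` locally noetherian: `M ↦ M ⊠ H` is right exact, `Rⁱ ⊠ H = p^*Rⁱ ⊗ q^*H` is coherent, and cokernels of coherent
modules are coherent. [cite: Hartshorne1977, II Prop. 5.7 and Ex. 5.1 (b)] [cite: StacksProject, Tag 0FXX and Tag 01BQ] -/
theorem coh_boxTensor (R : StrictlyPerfectResolution G) (hH : Coh H) : Coh (boxTensor p q G H) := by
  haveI := additive_boxTensorFunctor_flip_obj p q H
  haveI := preservesFiniteColimits_boxTensorFunctor_flip_obj p q H
  -- the terms `Rⁱ ⊠ H = p^*Rⁱ ⊗ q^*H` are coherent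
  have hT : ∀ i, Coh (((boxTensorFunctor p q).flip.obj H).obj (R.P.X i)) := fun i =>
    coh_tensorObj_of_isFiniteLocallyFree ((R.isFiniteLocallyFree i).pullback p) (coh_pullback q H hH)
  -- `G ≅ coker(R⁻¹ → R⁰)`
  haveI : Epi R.augmentation.g := R.epi_π
  let e : cokernel (R.P.d (-1) 0) ≅ G := (cokernelIsCokernel (R.P.d (-1) 0)).coconePointUniqueUpToIso R.exact_π.gIsCokernel
  have hc : Coh (cokernel (((boxTensorFunctor p q).flip.obj H).map (R.P.d (-1) 0))) := Coh.cokernel _ (hT _) (hT _)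
  exact coh_of_iso ((PreservesCokernel.iso ((boxTensorFunctor p q).flip.obj H) (R.P.d (-1) 0)).symm ≪≫
    ((boxTensorFunctor p q).flip.obj H).mapIso e) hc

end Literature.AlgebraicGeometry.Modules

end
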